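import Summits.BirchSwinnertonDyer.BirchSwinnertonDyer.Theorems.EisensteinPrimesGoodLatticeResidualPairScalarsAtMultiplicativeAll
import Summits.BirchSwinnertonDyer.BirchSwinnertonDyer.Theorems.EisensteinPrimesGoodLatticeAnacongEulerCompMultiplicative
import Summits.BirchSwinnertonDyer.BirchSwinnertonDyer.Theorems.EisensteinPrimesGoodLatticeAnacongEulerCompAdditive
import Literature.NumberTheory.EllipticCurves.NonEisensteinPrimeOfSurjective
import HarnessLib

/-!
# (eq:Euler-comp) ASSEMBLED for the good lattice: over the places `w ∣ N_E` of `K`,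
# `Σ_{w∈Sf} (λ(𝒫_w(θsub)) + λ(𝒫_w(θquot))) = Σ_{w∈Sf} λ(𝒫_w(f_E)) + Σ_{w∈Sf} corr_w` in closed form

Cell `bsd-eis`, width seat `bsd-line-x1-p1-w2` gen 24, crux 2 `GoodLatticeBDPValue` (stmt-BirchSwinnertonDyer-19032), line
`halves` v33N; helper `--supports`, closes no stub. PROVED, no named fact, no `sorry`.

WHY. The CONTENT stub 3a-A (`KellerYin2024.thm222_anacong_goodLattice_of_fullDescentDatum`) concludes
`n + Σ_{w∈Sf} curveLocalLambda κ E_K w = 2·nφ + Σ_{w∈Sf} (charLocalLambda θsub w + charLocalLambda θquot w)` with `Sf`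
the places of `K` above `N_E`. In Castella–Grossi–Lee–Skinner's proof of Thm. 2.2.2 (held text paper:arxiv-2008.02571 p. 12
L104–121) this is `λ(𝓛_E) = 2λ(𝓛_φ) + λ((𝓔^ι_{φ,ψ})²)` with (eq:Euler-comp)
`λ((𝓔^ι)²) = Σ_{w∈S} {λ(𝒫_w(φ)) + λ(𝒫_w(ψ)) − λ(𝒫_w(E))}`, evaluated place by place through the congruences
`a_ℓ ≡ φ(ℓ), ψ(ℓ), 0` of Thm. 2.2.1 at `ℓ ∣ N₊, N₋, N₀`. Width seat -w2 gen 23 kernelised the summands: multiplicative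
places (`…GoodLatticeAnacongEulerCompMultiplicative`, non-split restricted to odd `ℓ`), additive places
(`…GoodLatticeAnacongEulerCompAdditive`), `w ↔ w̄` (`…GoodLatticeAnacongEulerCompSymmetry`). This file (i) lifts the
`ℓ ≠ 2` restriction through gen 24's every-`ℓ` scalars (`…GoodLatticeResidualPairScalarsAtMultiplicativeAll`), (ii) dispatches a
place `w ∋ N_E` on the reduction type of `E` at the prime `ℓ` below it (`ℓ ≠ p` because `p` is good; `f(w|ℓ) = 1` by
(Heeg)), and (iii) sums over `Sf`, so that at the binders of 3a-A its conclusion is EQUIVALENT to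
`n = 2·nφ + Σ_{w∈Sf} corr_w` with the closed-form correction
`corr_w = [Γ:Γ_w]·[E split multiplicative at ℓ] + [E additive at ℓ]·(charLocalLambda θsub w + charLocalLambda θquot w)`
— i.e. `λ(𝓛_E) = 2λ(𝓛_φ) + 2λ(𝓔_{φ,ψ})` with `2λ(𝓔)` written over BOTH places above each `ℓ` (the `w ↔ w̄` symmetry
halves it back to CGLS's one-place-per-`ℓ` `λ(𝓔)`).

* §1 **`eulerComp_summand_of_hasMultiplicativeReductionAtPrime'`** (+ `…_of_heegner'`) — -w2 g23's closed-form
  multiplicative summand `char θsub + char θquot = curve + [split]·[Γ:Γ_w]` WITHOUT `¬split → ℓ ≠ 2`.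
* §2 **`eulerComp_summand_of_conductor_mem`** — at a place `w ∋ N_E` (Heegner for `N_E`, `p` good):
  `char θsub w + char θquot w = curve w + corr_w`.
* §3 **`eulerComp_sum`** — summed over `Sf = {w : N_E ∈ w}`; **`anacong_conclusion_iff`** — 3a-A's displayed identity
  `⟺ n = 2·nφ + Σ_{w∈Sf} corr_w`.

HONEST FRAMING: helper lemmas on the tree's own objects; 0 stubs / cells / labels / tiers move; orphan for -19032 until a
CGLS-2.2.1-shaped typing of 3a-A consumes it (director key (β)); no summit statement, no case of BSD, no crux or stub, no
Keller–Yin / CGLS theorem is proved here.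
References: [CastellaGrossiLeeSkinner2022] Thm. 2.2.1 / proof of Thm. 2.2.2 (eq:Euler-comp), (2.16); [GreenbergVatsal2000]
§2 Prop. (2.4), pp. 14–15, 27; [KellerYin2024] Lemma 1.1.1, §1.5, Thm. 2.2.2 (shape); [SilvermanAEC2009] VII.5.1, VII.5.4,
§C.16; [DiamondShurman2005] §8.3 (`ℓ ∣ N_E` iff bad); [GrossLMS1991] §1 (Heegner hypothesis).
-/

set_option autoImplicit false
set_option linter.dupNamespace false

noncomputable section

open scoped Classical

open NumberField IsDedekindDomain Field WeierstrassCurve Polynomial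
  Literature.NumberTheory.EllipticCurves Literature.NumberTheory.GaloisRepresentations
  Literature.NumberTheory.EllipticCurves.Rank1Residual
  Literature.NumberTheory.EllipticCurves.KellerYin2024
  IsDedekindDomain.HeightOneSpectrum Rat.HeightOneSpectrum
  Summit.BirchSwinnertonDyer.BirchSwinnertonDyer.Theorems.GoodLatticeAnacongEulerCompMultiplicative

namespace Summit.BirchSwinnertonDyer.BirchSwinnertonDyer.Theorems.GoodLatticeAnacongEulerCompSum

variable {p : ℕ} [hp : Fact p.Prime] {S : Set (PadicAlgCl p)}
  (W : WeierstrassCurve ℚ) [W.IsElliptic] [W.IsGloballyMinimal] (K : Type) [Field K] [NumberField K]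

/-! ## §1 The (eq:Euler-comp) summand at a multiplicative `ℓ ≠ p`, closed form, every prime `ℓ` -/

/-- **(eq:Euler-comp) at a multiplicative `ℓ ≠ p`, closed form, EVERY prime `ℓ`.** For `W/ℚ` globally minimal, `2 < p`,
`Red`, `Anom`, (hlat), `K` imaginary quadratic with `p` split, any `ℤ_p`-extension `κ`, a residual pair `(θsub, θquot)` of `E[p]`
over `K`, a prime `ℓ ≠ p` of multiplicative reduction (split or not, `ℓ = 2` allowed) and a place `w ∋ ℓ` of residue degree one:
`charLocalLambda S κ θsub w + charLocalLambda S κ θquot w = curveLocalLambda κ (W⁄K) w + [split]·numPlacesAbove κ w`.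
The statement of -w2 g23's `GoodLatticeAnacongEulerCompMultiplicative.eulerComp_summand_of_hasMultiplicativeReductionAtPrime`
WITHOUT `¬split → ℓ ≠ 2`; same proof, the scalars taken from gen 24's every-`ℓ`
`residualPair_frob_scalars_of_hasMultiplicativeReductionAtPrime'`. [cite: CastellaGrossiLeeSkinner2022, Thm. 2.2.1 (a_ℓ ≡ φ(ℓ), ψ(ℓ) at ℓ ∥ N) and proof of Thm. 2.2.2 (eq:Euler-comp)]
[cite: GreenbergVatsal2000, §2 Prop. (2.4), pp. 14–15] [cite: KellerYin2024, Lemma 1.1.1 and §1.5 (arXiv:2402.12781v2 TeX L455–462, L1337–1341)] -/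
theorem eulerComp_summand_of_hasMultiplicativeReductionAtPrime' (hp2 : 2 < p) (hred : Red W p)
    (hanom : Anom W p)
    (hlat : ∀ Φ : AddSubgroup (geomTorsion W (p : ℤ)), IsRationalLine W p Φ → ¬ LineUnramifiedAt W p Φ)
    (hK : IsImaginaryQuadratic K) (hHp : SatisfiesHeegnerHypothesis p K) (κ : ZpExtension K p)
    {θsub θquot : FramedGaloisRep K (padicCoeffIntegers S) 1} (h : IsResidualPairOver (W.baseChange K) p θsub θquot)
    {ℓ : ℕ} [hℓ : Fact ℓ.Prime] (hℓp : ℓ ≠ p) (hmult : W.HasMultiplicativeReductionAtPrime ℓ)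
    {w : HeightOneSpectrum (𝓞 K)} (hw : ((ℓ : ℕ) : 𝓞 K) ∈ w.asIdeal) (hf : w.asIdeal.inertiaDeg (𝓞 ℚ) = 1) :
    charLocalLambda S κ θsub w + charLocalLambda S κ θquot w =
      curveLocalLambda κ (W.baseChange K) w +
        (if W.HasSplitMultiplicativeReductionAtPrime ℓ then numPlacesAbove κ w else 0) := by
  -- adapted from -w2 g23's `eulerComp_summand_of_hasMultiplicativeReductionAtPrime` (non-split odd `ℓ`)
  have hpp := hp.out
  -- a Frobenius above `w`, unramifiedness, the scalars
  obtain ⟨𝔓, h𝔓⟩ := HeightOneSpectrum.primesAbove_nonempty w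
  obtain ⟨σ₀, hσ₀⟩ := HeightOneSpectrum.exists_isArithFrobAt_of_mem_primesAbove_holds h𝔓
  obtain ⟨hunr_sub, hunr_quot⟩ :=
    ResidualPairUnramifiedAtMultiplicative.isUnramifiedAt_baseChange_of_hasMultiplicativeReductionAtPrime W h hℓp hmult hw
  obtain ⟨a, b, ha, hb, hsplit, hns⟩ :=
    GoodLatticeResidualPairScalarsAtMultiplicativeAll.residualPair_frob_scalars_of_hasMultiplicativeReductionAtPrime' W K
      hp2 hred hanom hlat hK hHp h hℓp hmult hw hf h𝔓 hσ₀
  have hN : Ideal.absNorm w.asIdeal = ℓ := absNorm_eq_of_inertiaDeg_eq_one hℓ.out hw hf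
  have hsubiff := frobActsAsNormAt_iff_intCast_eq hunr_sub h𝔓 hσ₀ ha hN
  have hquotiff := frobActsAsNormAt_iff_intCast_eq hunr_quot h𝔓 hσ₀ hb hN
  -- the place of `ℚ` below `w`
  have hℓv : ((ℓ : ℕ) : 𝓞 ℚ) ∈ (w.under (𝓞 ℚ)).asIdeal := by
    change ((ℓ : ℕ) : 𝓞 ℚ) ∈ w.asIdeal.comap (algebraMap (𝓞 ℚ) (𝓞 K))
    rw [Ideal.mem_comap, map_natCast]; exact hw
  have hmultv : W.HasMultiplicativeReductionAt (w.under (𝓞 ℚ)) :=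
    Summit.BirchSwinnertonDyer.Rank1Residual.X2.GreenbergVatsalStrictSelmerMultiplicative.hasMultiplicativeReductionAt_of_mem
      W ℓ hmult hℓv
  have hvℓ : ((Rat.HeightOneSpectrum.primesEquiv (w.under (𝓞 ℚ)) : Nat.Primes) : ℕ) = ℓ :=
    Rat.HeightOneSpectrum.primesEquiv_eq_of_natCast_mem _ hℓ.out hℓv
  have hℓ0 : (ℓ : ZMod p) ≠ 0 := by
    rw [Ne, ZMod.natCast_eq_zero_iff]
    exact fun h ↦ hℓp ((Nat.prime_dvd_prime_iff_eq hpp hℓ.out).mp h).symm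
  have h2ne : (2 : ZMod p) ≠ 0 := by
    intro h2
    have h2' : ((2 : ℕ) : ZMod p) = 0 := by exact_mod_cast h2
    rw [ZMod.natCast_eq_zero_iff] at h2'
    have := (Nat.prime_dvd_prime_iff_eq hpp Nat.prime_two).mp h2'
    omega
  have hnegℓ : ¬ (-(ℓ : ZMod p) = (ℓ : ZMod p)) := by
    intro hneg
    have h2ℓ : (2 : ZMod p) * (ℓ : ZMod p) = 0 := by
      rw [two_mul]; nth_rewrite 1 [← hneg]; rw [neg_add_cancel]
    rcases mul_eq_zero.mp h2ℓ with h | h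
    · exact h2ne h
    · exact hℓ0 h
  have hcs : charLocalLambda S κ θsub w = numPlacesAbove κ w * (if (a : ZMod p) = (ℓ : ZMod p) then 1 else 0) := by
    simp only [charLocalLambda, hsubiff]
  have hcq : charLocalLambda S κ θquot w = numPlacesAbove κ w * (if (b : ZMod p) = (ℓ : ZMod p) then 1 else 0) := by
    simp only [charLocalLambda, hquotiff]
  rw [hcs, hcq]
  by_cases hsp : W.HasSplitMultiplicativeReductionAtPrime ℓ
  · -- SPLIT: `L_ℓ(E) = 1 − T`
    have hsplitv : W.HasSplitMultiplicativeReductionAt (w.under (𝓞 ℚ)) := by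
      refine (WeierstrassCurve.hasSplitMultiplicativeReductionAtPrime_iff_hasSplitMultiplicativeReductionAt W
        (w.under (𝓞 ℚ))).mp ?_
      have key : ∀ (q : ℕ) (hq' : Fact q.Prime), q = ℓ →
          (haveI := hq'; W.HasSplitMultiplicativeReductionAtPrime q) := by
        rintro q hq' rfl; exact hsp
      exact key _ _ hvℓ
    have hL : W.localPolynomialAt (w.under (𝓞 ℚ)) = 1 - C (1 : ℤ) * X := by
      rw [localPolynomialAt_of_hasSplitMultiplicativeReductionAt hsplitv, map_one, one_mul]
    rw [if_pos hsp, curveLocalLambda_baseChange_of_hasMultiplicativeReductionAt W κ hℓ.out hℓp hw hf hmultv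
      (Or.inl rfl) hL, Int.cast_one]
    rcases hsplit hsp with ⟨h1, h2⟩ | ⟨h1, h2⟩
    · rw [h1, h2, if_pos rfl]
      split_ifs <;> ring
    · rw [h1, h2, if_pos rfl]
      split_ifs <;> ring
  · -- NON-SPLIT, every `ℓ`: `L_ℓ(E) = 1 + T`
    have hnsv : ¬ W.HasSplitMultiplicativeReductionAt (w.under (𝓞 ℚ)) := by
      intro hsplitv
      apply hsp
      have h' := (WeierstrassCurve.hasSplitMultiplicativeReductionAtPrime_iff_hasSplitMultiplicativeReductionAt W
        (w.under (𝓞 ℚ))).mpr hsplitv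
      have key : ∀ (q : ℕ) (hq' : Fact q.Prime), q = ℓ →
          (haveI := hq'; W.HasSplitMultiplicativeReductionAtPrime q) → W.HasSplitMultiplicativeReductionAtPrime ℓ := by
        rintro q hq' rfl h''; exact h''
      exact key _ _ hvℓ h'
    have hL : W.localPolynomialAt (w.under (𝓞 ℚ)) = 1 - C (-1 : ℤ) * X := by
      rw [localPolynomialAt_of_hasMultiplicativeReductionAt_of_not_hasSplitMultiplicativeReductionAt hmultv hnsv,
        map_neg, map_one]; ring
    rw [if_neg hsp, curveLocalLambda_baseChange_of_hasMultiplicativeReductionAt W κ hℓ.out hℓp hw hf hmultv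
      (Or.inr rfl) hL, Int.cast_neg, Int.cast_one]
    rcases hns hsp with ⟨h1, h2⟩ | ⟨h1, h2⟩
    · rw [h1, h2, if_neg hnegℓ]
      split_ifs <;> ring
    · rw [h1, h2, if_neg hnegℓ]
      split_ifs <;> ring

/-- **The same with `f(w|ℓ) = 1` supplied by the Heegner hypothesis** (`ℓ ∣ N` splits in `K`; tree
`UnrSelmerQuotientTorsionFiniteChar.ramificationIdx_inertiaDeg_eq_one_of_heegner`), every prime `ℓ`.
[cite: CastellaGrossiLeeSkinner2022, proof of Thm. 2.2.2 (eq:Euler-comp)] [cite: GreenbergVatsal2000, §2 Prop. (2.4)] -/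
theorem eulerComp_summand_of_hasMultiplicativeReductionAtPrime_of_heegner' (hp2 : 2 < p) (hred : Red W p)
    (hanom : Anom W p)
    (hlat : ∀ Φ : AddSubgroup (geomTorsion W (p : ℤ)), IsRationalLine W p Φ → ¬ LineUnramifiedAt W p Φ)
    (hK : IsImaginaryQuadratic K) (hHp : SatisfiesHeegnerHypothesis p K) {N : ℕ} (hHN : SatisfiesHeegnerHypothesis N K)
    (κ : ZpExtension K p)
    {θsub θquot : FramedGaloisRep K (padicCoeffIntegers S) 1} (h : IsResidualPairOver (W.baseChange K) p θsub θquot)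
    {ℓ : ℕ} [hℓ : Fact ℓ.Prime] (hℓp : ℓ ≠ p) (hmult : W.HasMultiplicativeReductionAtPrime ℓ)
    {w : HeightOneSpectrum (𝓞 K)} (hw : ((ℓ : ℕ) : 𝓞 K) ∈ w.asIdeal) (hNw : ((N : ℤ) : 𝓞 K) ∈ w.asIdeal) :
    charLocalLambda S κ θsub w + charLocalLambda S κ θquot w =
      curveLocalLambda κ (W.baseChange K) w +
        (if W.HasSplitMultiplicativeReductionAtPrime ℓ then numPlacesAbove κ w else 0) :=
  eulerComp_summand_of_hasMultiplicativeReductionAtPrime' W K hp2 hred hanom hlat hK hHp κ h hℓp hmult hw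
    (UnrSelmerQuotientTorsionFiniteChar.ramificationIdx_inertiaDeg_eq_one_of_heegner hK hHN w hNw).2

/-! ## §2 The summand at a place `w ∋ N_E`, dispatched on the reduction type of `E` at the prime below `w` -/

/-- **(eq:Euler-comp) summand at a place `w ∣ N_E` of `K`, closed form.** `W/ℚ` globally minimal with `p` GOOD, `2 < p`,
`Red`, `Anom`, (hlat), `K` imaginary quadratic with (Heeg) for `N_E` and `p` split, any `κ`, a residual pair over `K`, and a
place `w ∋ N_E`: with `u` the place of `ℚ` below `w` (a prime `ℓ ∣ N_E`, so `ℓ ≠ p` and `E` is multiplicative or additive at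
`ℓ`; `f(w|ℓ) = 1`),
`char θsub w + char θquot w = curve w + (split mult. at ℓ ? [Γ:Γ_w] : mult. at ℓ ? 0 : char θsub w + char θquot w)`
— §1 at multiplicative `ℓ` (every `ℓ`), -w2 g23's `…EulerCompAdditive` at additive `ℓ` (`curve w = 0`).
[cite: CastellaGrossiLeeSkinner2022, Thm. 2.2.1 (a_ℓ ≡ φ(ℓ), ψ(ℓ), 0 at ℓ ∣ N₊, N₋, N₀) and proof of Thm. 2.2.2 (eq:Euler-comp)]
[cite: DiamondShurman2005, §8.3 (ℓ ∣ N_E iff bad reduction)] [cite: SilvermanAEC2009, VII.5 Prop. 5.1 and §C.16] -/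
theorem eulerComp_summand_of_conductor_mem (hp2 : 2 < p) (hgood : Good W p) (hred : Red W p) (hanom : Anom W p)
    (hlat : ∀ Φ : AddSubgroup (geomTorsion W (p : ℤ)), IsRationalLine W p Φ → ¬ LineUnramifiedAt W p Φ)
    (hK : IsImaginaryQuadratic K) (hH : SatisfiesHeegnerHypothesis (W.conductorNorm ℤ) K)
    (hHp : SatisfiesHeegnerHypothesis p K) (κ : ZpExtension K p)
    {θsub θquot : FramedGaloisRep K (padicCoeffIntegers S) 1} (h : IsResidualPairOver (W.baseChange K) p θsub θquot)
    {w : HeightOneSpectrum (𝓞 K)} (hwN : ((W.conductorNorm ℤ : ℤ) : 𝓞 K) ∈ w.asIdeal) :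
    charLocalLambda S κ θsub w + charLocalLambda S κ θquot w =
      curveLocalLambda κ (W.baseChange K) w +
        (if W.HasSplitMultiplicativeReductionAt (w.under (𝓞 ℚ)) then numPlacesAbove κ w
          else if W.HasMultiplicativeReductionAt (w.under (𝓞 ℚ)) then 0
          else charLocalLambda S κ θsub w + charLocalLambda S κ θquot w) := by
  have hpp := hp.out
  -- the prime `ℓ ∣ N_E` below `w`; `ℓ ≠ p`
  set u := w.under (𝓞 ℚ) with hu
  set ℓ := natGenerator u with hℓ
  have hℓprime : ℓ.Prime := prime_natGenerator u
  haveI hℓfact : Fact ℓ.Prime := ⟨hℓprime⟩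
  have hℓw : (ℓ : 𝓞 K) ∈ w.asIdeal := SelmerAcQuotientCorankLeCurveLocalLambda.natCast_natGenerator_under_mem w
  have hℓN : ℓ ∣ W.conductorNorm ℤ := SelmerAcQuotientCorankLeCurveLocalLambda.natGenerator_under_dvd_of_mem w hwN
  have hpN : ¬ p ∣ W.conductorNorm ℤ := not_dvd_conductorNorm_of_hasGoodReductionAtPrime W hgood
  have hℓp : ℓ ≠ p := fun h' ↦ hpN (h' ▸ hℓN)
  have hbad : ¬ W.HasGoodReductionAt u := (W.dvd_conductorNorm_iff u).mp hℓN
  by_cases hmult : W.HasMultiplicativeReductionAt u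
  · -- multiplicative at `ℓ`
    have hmultℓ : W.HasMultiplicativeReductionAtPrime ℓ :=
      (W.hasMultiplicativeReductionAtPrime_iff_hasMultiplicativeReductionAt_ringOfIntegers u).2 hmult
    have key := eulerComp_summand_of_hasMultiplicativeReductionAtPrime_of_heegner' W K hp2 hred hanom hlat hK hHp hH κ
      h hℓp hmultℓ hℓw hwN
    by_cases hsplit : W.HasSplitMultiplicativeReductionAt u
    · have hsplitℓ : W.HasSplitMultiplicativeReductionAtPrime ℓ :=
        (W.hasSplitMultiplicativeReductionAtPrime_iff_hasSplitMultiplicativeReductionAt u).2 hsplit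
      rw [if_pos hsplitℓ] at key
      rw [if_pos hsplit]
      exact key
    · have hnsℓ : ¬ W.HasSplitMultiplicativeReductionAtPrime ℓ := fun h' ↦
        hsplit ((W.hasSplitMultiplicativeReductionAtPrime_iff_hasSplitMultiplicativeReductionAt u).1 h')
      rw [if_neg hnsℓ] at key
      rw [if_neg hsplit, if_pos hmult]
      exact key
  · -- additive at `ℓ`
    have hadd : W.HasAdditiveReductionAt u :=
      (Summit.BirchSwinnertonDyer.Rank1Residual.X2.NonPrimitiveLambdaShiftRat.additive_or_multiplicative_of_not_hasGoodReductionAt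
        W hbad).resolve_right hmult
    have hns : ¬ W.HasSplitMultiplicativeReductionAt u := fun h' ↦ hmult h'.hasMultiplicativeReductionAt
    rw [if_neg hns, if_neg hmult]
    exact GoodLatticeAnacongEulerCompAdditive.eulerComp_summand_of_hasAdditiveReductionAt_of_heegner W hK hH κ S θsub
      θquot hwN hadd

/-! ## §3 The sum over `Sf` and the shape of 3a-A's conclusion -/

/-- **(eq:Euler-comp) ASSEMBLED over `Sf = {w : N_E ∈ w}`**, closed form, at the binders of the content stub 3a-A:
`Σ_{w∈Sf} (char θsub w + char θquot w) = Σ_{w∈Sf} curve w + Σ_{w∈Sf} corr_w`,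
`corr_w = (split mult. at ℓ_w ? [Γ:Γ_w] : mult. ? 0 : char θsub w + char θquot w)` — CGLS's
`λ((𝓔^ι_{φ,ψ})²) = Σ_{w∈S}{λ(𝒫_w(φ)) + λ(𝒫_w(ψ)) − λ(𝒫_w(E))}` with every local `λ` a closed-form number and `w` over ALL
places above `N_E`. [cite: CastellaGrossiLeeSkinner2022, proof of Thm. 2.2.2 (eq:Euler-comp) (arXiv:2008.02571v2 §2.2)]
[cite: KellerYin2024, Thm. 2.2.2 (anacong; the Σ_{w∈Sf} shape)] -/
theorem eulerComp_sum (hp2 : 2 < p) (hgood : Good W p) (hred : Red W p) (hanom : Anom W p)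
    (hlat : ∀ Φ : AddSubgroup (geomTorsion W (p : ℤ)), IsRationalLine W p Φ → ¬ LineUnramifiedAt W p Φ)
    (hK : IsImaginaryQuadratic K) (hH : SatisfiesHeegnerHypothesis (W.conductorNorm ℤ) K)
    (hHp : SatisfiesHeegnerHypothesis p K) (κ : ZpExtension K p)
    {θsub θquot : FramedGaloisRep K (padicCoeffIntegers S) 1} (h : IsResidualPairOver (W.baseChange K) p θsub θquot)
    (Sf : Finset (HeightOneSpectrum (𝓞 K)))
    (hSf : ∀ w : HeightOneSpectrum (𝓞 K), w ∈ Sf ↔ ((W.conductorNorm ℤ : ℤ) : 𝓞 K) ∈ w.asIdeal) :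
    ∑ w ∈ Sf, (charLocalLambda S κ θsub w + charLocalLambda S κ θquot w) =
      ∑ w ∈ Sf, curveLocalLambda κ (W.baseChange K) w +
        ∑ w ∈ Sf, (if W.HasSplitMultiplicativeReductionAt (w.under (𝓞 ℚ)) then numPlacesAbove κ w
          else if W.HasMultiplicativeReductionAt (w.under (𝓞 ℚ)) then 0
          else charLocalLambda S κ θsub w + charLocalLambda S κ θquot w) := by
  rw [← Finset.sum_add_distrib]
  exact Finset.sum_congr rfl fun w hw ↦
    eulerComp_summand_of_conductor_mem W K hp2 hgood hred hanom hlat hK hH hHp κ h ((hSf w).mp hw)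

/-- **The conclusion of 3a-A in (eq:Euler-comp) form**: at the content stub's binders, for any `n nφ : ℕ`,
`n + Σ_{w∈Sf} curve w = 2·nφ + Σ_{w∈Sf} (char θsub w + char θquot w)  ⟺  n = 2·nφ + Σ_{w∈Sf} corr_w` —
`λ(𝓛_E) = 2·λ(𝓛_φ) + 2·λ(𝓔_{φ,ψ})` with `2λ(𝓔)` spread over both places above each `ℓ ∣ N_E` (CGLS Thm. 2.2.1's exponent
`(𝓔^ι)²` and (2.16) `λ(𝓛_ψ) = λ(𝓛_φ)`). [cite: CastellaGrossiLeeSkinner2022, Thm. 2.2.1 and proof of Thm. 2.2.2 ((eq:Euler-comp), (2.16))]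
[cite: KellerYin2024, Thm. 2.2.2 (anacong; arXiv:2402.12781v2 TeX L1445–1448)] -/
theorem anacong_conclusion_iff (hp2 : 2 < p) (hgood : Good W p) (hred : Red W p) (hanom : Anom W p)
    (hlat : ∀ Φ : AddSubgroup (geomTorsion W (p : ℤ)), IsRationalLine W p Φ → ¬ LineUnramifiedAt W p Φ)
    (hK : IsImaginaryQuadratic K) (hH : SatisfiesHeegnerHypothesis (W.conductorNorm ℤ) K)
    (hHp : SatisfiesHeegnerHypothesis p K) (κ : ZpExtension K p)
    {θsub θquot : FramedGaloisRep K (padicCoeffIntegers S) 1} (h : IsResidualPairOver (W.baseChange K) p θsub θquot)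
    (Sf : Finset (HeightOneSpectrum (𝓞 K)))
    (hSf : ∀ w : HeightOneSpectrum (𝓞 K), w ∈ Sf ↔ ((W.conductorNorm ℤ : ℤ) : 𝓞 K) ∈ w.asIdeal) (n nφ : ℕ) :
    (n + ∑ w ∈ Sf, curveLocalLambda κ (W.baseChange K) w =
        2 * nφ + ∑ w ∈ Sf, (charLocalLambda S κ θsub w + charLocalLambda S κ θquot w)) ↔
      n = 2 * nφ +
        ∑ w ∈ Sf, (if W.HasSplitMultiplicativeReductionAt (w.under (𝓞 ℚ)) then numPlacesAbove κ w
          else if W.HasMultiplicativeReductionAt (w.under (𝓞 ℚ)) then 0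
          else charLocalLambda S κ θsub w + charLocalLambda S κ θquot w) := by
  rw [eulerComp_sum W K hp2 hgood hred hanom hlat hK hH hHp κ h Sf hSf]
  omega

end Summit.BirchSwinnertonDyer.BirchSwinnertonDyer.Theorems.GoodLatticeAnacongEulerCompSum

end
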